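import Summits.QuantumFields.YangMills.Theses.RevelationMartingale
import Summits.QuantumFields.YangMills.Theorems.UnitScaleTiltHistoryTailLOfFirstExitTail
import Summits.QuantumFields.YangMills.Theorems.RevelationMartingaleWindowTail
import Summits.QuantumFields.YangMills.Theorems.RevelationMartingalePredictableHoeffding
import Summits.QuantumFields.YangMills.Theorems.RevelationMartingaleBondFiltration
import Summits.QuantumFields.YangMills.Theorems.RevelationMartingaleMeanDeviationSplit
import Literature.MathematicalPhysics.QuantumFieldTheory.Balaban1983to89.T3YM3TorusStatement

/-!
# LINE 13 «revelation_martingale» v3 — skeleton for crux `UnitScaleTilt.HistoryTailL` (stmt-QuantumFields-19936)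

Route: `route-QuantumFields-RevelationMartingale` (ideator ym-r3-idea-2 g6, lens nearmiss).  v2, after the engine
`PredictableHoeffding` (p656379) and the glue `WindowTailOfMartingale` (p655698) LANDED and the bond-revelation filtration was
typed (`Theorems.RevelationMartingaleBondFiltration`, p657133): the stubs are now MECHANISM-SPECIFIC — the filtration is THE bond
revelation along some enumeration `e` of the finest bonds (`ℱ i` = pull-back of the product σ-algebra under the masked revelation
map `U ↦ (m ↦ if m < i then U (e m) else 1)`), not an arbitrary `∃ ℱ`; the trivial / two-step filtrations (whose instances would
be the global or windowed sub-Gaussian MGF, i.e. the 28309 / 27836 currencies) are thereby EXCLUDED from the line's obligations.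

* `stub_levelOneBondRevelation` — level `j = 1` (first rung, BC5 plan-only; size L): one averaging step above the bare lattice;
  the conditional law of a bond given the revealed ones is a one-link Wilson–Gibbs law at stiffness `β_K` tilted by the averaging
  weight; proxies from the one-link conditional Herbst bound dressed by the revealed neighbourhood (Bałaban B7 (10), B10 (47)).
* `stub_higherBondRevelation` — levels `2 ≤ j ≤ K` (HARDEST, XL): the proxy sum must telescope to `Cv·g_(K−j)²` on the first-exit
  window although the white-noise count `Σ_b Lip_b² = 4·L^(−j)` is `≫ g²` for `2j < K`: the ADAPTED proxies must exploit the revealed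
  small-field profile (levels `< j` are `θ(b₀)`-small on `W`) — this is where the line meets the known wall (priced, not dodged).
* `stub_meanDeviationShallow` / `stub_meanDeviationDeep` — the centring crux `MeanDeviationL` (stmt-23083) SPLIT BY DEPTH (critic #137
  price 1; route edit rev 1, glue `MeanDeviationLGlue` stmt-23135 LANDED p658413): shallow `N₁·j ≤ K` (stmt-23133, first rung, M–L:
  Gaussian domination at super-weak coupling) and deep `K < N₁·j` (stmt-23134, organ-adjacent, one reader with the deep deciding part).
Composition: `bondRevelation_of` (min/max merge of the two depth ranges) → landed
`revelationMartingale_subGaussianRevelationL_of_bondRevelation` → landed glue `revelationMartingale_windowTailOfMartingale_proof` with the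
landed engine `revelationMartingale_predictableHoeffding_proof` → landed `unitScaleTilt_historyTailL_of_firstExitWindowTailL` → the crux
BY NAME (`HistoryTailL_of`).  No summit and no rung is proved by this skeleton.
-/

namespace Summit.QuantumFields.YangMills.Cruxes.HistoryTailL.RevelationMartingale

open scoped BigOperators Classical MeasureTheory
open MeasureTheory Literature.MathematicalPhysics.QuantumFieldTheory.Balaban1983to89
  Literature.MathematicalPhysics.QuantumFieldTheory.Balaban1983to89.T3ContinuumYM3Torus
  Summit.QuantumFields.YangMills.Theorems

/-- STUB (first rung, `j = 1`; BC5 plan-only): bond-revelation proxies one averaging level above the bare lattice. -/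
theorem stub_levelOneBondRevelation :
    ∀ (L : ℕ) (b₀ p₀ b₂ : ℝ), 0 < b₀ → 2 < p₀ → b₀ ≤ b₂ → ∃ (γ₁ Cv : ℝ), 0 < γ₁ ∧ γ₁ ≤ 1 ∧ 0 < Cv ∧
          ∀ (F : T3Family) (γ : ℝ), F.L = L → 0 < γ → γ ≤ γ₁ → ∀ (K j : ℕ), j = 1 → 1 ≤ K → ∀ p : Plaq (F.P K) j,
          ∃ (N : ℕ) (e : Fin N → PBond (F.P K) 0), Function.Surjective e ∧
            ∀ ℱ : MeasureTheory.Filtration ℕ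
                (inferInstance : MeasurableSpace (GaugeField (F.P K) 0 (Matrix.specialUnitaryGroup (Fin 2) ℂ))),
              (∀ i, ℱ i = MeasurableSpace.comap
                (fun (U : GaugeField (F.P K) 0 (Matrix.specialUnitaryGroup (Fin 2) ℂ)) (m : Fin N) =>
                  if (m : ℕ) < i then U (e m) else (1 : Matrix.specialUnitaryGroup (Fin 2) ℂ)) inferInstance) →
            ∃ σ : ℕ → GaugeField (F.P K) 0 (Matrix.specialUnitaryGroup (Fin 2) ℂ) → ℝ,
              (∀ i, StronglyMeasurable[ℱ i] (σ i)) ∧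
              (∀ i U, 0 ≤ σ i U) ∧
              (∀ (i : ℕ) (s : ℝ), ∀ᵐ U ∂(T3UnitScaleTilt.gibbsK F T3UnitLawDensityEML.ℰp γ K),
                MeasureTheory.condExp (ℱ i) (T3UnitScaleTilt.gibbsK F T3UnitLawDensityEML.ℰp γ K)
                  (fun U' => Real.exp (s *
                    (MeasureTheory.condExp (ℱ (i + 1)) (T3UnitScaleTilt.gibbsK F T3UnitLawDensityEML.ℰp γ K)
                        (fun V => GaugeGroup.dist1 (GaugeField.plaqHol
                          (Averaging.iter (fun i => BlockAveraging.blockAvg (P := F.P K) (j := i) T3UnitLawDensityEML.ℰp) j V) p)) U' -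
                     MeasureTheory.condExp (ℱ i) (T3UnitScaleTilt.gibbsK F T3UnitLawDensityEML.ℰp γ K)
                        (fun V => GaugeGroup.dist1 (GaugeField.plaqHol
                          (Averaging.iter (fun i => BlockAveraging.blockAvg (P := F.P K) (j := i) T3UnitLawDensityEML.ℰp) j V) p)) U'))) U
                  ≤ Real.exp (s ^ 2 * σ i U / 2)) ∧
              (∀ᵐ U ∂(T3UnitScaleTilt.gibbsK F T3UnitLawDensityEML.ℰp γ K),
                ((∀ k, k < j → PlaqSmall (T3UnitScaleTilt.θBal F.L γ b₀ p₀ (K - k))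
                    (Averaging.iter (fun i => BlockAveraging.blockAvg (P := F.P K) (j := i) T3UnitLawDensityEML.ℰp) k U)) ∧
                  PlaqSmall (T3UnitScaleTilt.θBal F.L γ b₂ p₀ (K - j))
                    (Averaging.iter (fun i => BlockAveraging.blockAvg (P := F.P K) (j := i) T3UnitLawDensityEML.ℰp) j U)) →
                ∑ i ∈ Finset.range N, σ i U ≤ Cv * (γ * ((F.L : ℝ)⁻¹) ^ (K - j))) := by
  sorry

/-- STUB (HARDEST, `2 ≤ j ≤ K`): bond-revelation proxies at depth, summing to `Cv·g_(K−j)²` on the first-exit window. -/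
theorem stub_higherBondRevelation :
    ∀ (L : ℕ) (b₀ p₀ b₂ : ℝ), 0 < b₀ → 2 < p₀ → b₀ ≤ b₂ → ∃ (γ₁ Cv : ℝ), 0 < γ₁ ∧ γ₁ ≤ 1 ∧ 0 < Cv ∧
          ∀ (F : T3Family) (γ : ℝ), F.L = L → 0 < γ → γ ≤ γ₁ → ∀ (K j : ℕ), 2 ≤ j → j ≤ K → ∀ p : Plaq (F.P K) j,
          ∃ (N : ℕ) (e : Fin N → PBond (F.P K) 0), Function.Surjective e ∧
            ∀ ℱ : MeasureTheory.Filtration ℕ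
                (inferInstance : MeasurableSpace (GaugeField (F.P K) 0 (Matrix.specialUnitaryGroup (Fin 2) ℂ))),
              (∀ i, ℱ i = MeasurableSpace.comap
                (fun (U : GaugeField (F.P K) 0 (Matrix.specialUnitaryGroup (Fin 2) ℂ)) (m : Fin N) =>
                  if (m : ℕ) < i then U (e m) else (1 : Matrix.specialUnitaryGroup (Fin 2) ℂ)) inferInstance) →
            ∃ σ : ℕ → GaugeField (F.P K) 0 (Matrix.specialUnitaryGroup (Fin 2) ℂ) → ℝ,
              (∀ i, StronglyMeasurable[ℱ i] (σ i)) ∧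
              (∀ i U, 0 ≤ σ i U) ∧
              (∀ (i : ℕ) (s : ℝ), ∀ᵐ U ∂(T3UnitScaleTilt.gibbsK F T3UnitLawDensityEML.ℰp γ K),
                MeasureTheory.condExp (ℱ i) (T3UnitScaleTilt.gibbsK F T3UnitLawDensityEML.ℰp γ K)
                  (fun U' => Real.exp (s *
                    (MeasureTheory.condExp (ℱ (i + 1)) (T3UnitScaleTilt.gibbsK F T3UnitLawDensityEML.ℰp γ K)
                        (fun V => GaugeGroup.dist1 (GaugeField.plaqHol
                          (Averaging.iter (fun i => BlockAveraging.blockAvg (P := F.P K) (j := i) T3UnitLawDensityEML.ℰp) j V) p)) U' -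
                     MeasureTheory.condExp (ℱ i) (T3UnitScaleTilt.gibbsK F T3UnitLawDensityEML.ℰp γ K)
                        (fun V => GaugeGroup.dist1 (GaugeField.plaqHol
                          (Averaging.iter (fun i => BlockAveraging.blockAvg (P := F.P K) (j := i) T3UnitLawDensityEML.ℰp) j V) p)) U'))) U
                  ≤ Real.exp (s ^ 2 * σ i U / 2)) ∧
              (∀ᵐ U ∂(T3UnitScaleTilt.gibbsK F T3UnitLawDensityEML.ℰp γ K),
                ((∀ k, k < j → PlaqSmall (T3UnitScaleTilt.θBal F.L γ b₀ p₀ (K - k))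
                    (Averaging.iter (fun i => BlockAveraging.blockAvg (P := F.P K) (j := i) T3UnitLawDensityEML.ℰp) k U)) ∧
                  PlaqSmall (T3UnitScaleTilt.θBal F.L γ b₂ p₀ (K - j))
                    (Averaging.iter (fun i => BlockAveraging.blockAvg (P := F.P K) (j := i) T3UnitLawDensityEML.ℰp) j U)) →
                ∑ i ∈ Finset.range N, σ i U ≤ Cv * (γ * ((F.L : ℝ)⁻¹) ^ (K - j))) := by
  sorry

/-- STUB (first rung of the centring, critic #137 price 1): the SHALLOW part `MeanDeviationShallowL` (stmt-QuantumFields-23133;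
depths `N₁·j ≤ K`, Gaussian domination at super-weak coupling; size M–L). -/
theorem stub_meanDeviationShallow : Summit.QuantumFields.YangMills.Theses.RevelationMartingale.MeanDeviationShallowL := by
  sorry

/-- STUB (organ-adjacent, one reader with the deep part of the deciding crux): the DEEP part `MeanDeviationDeepL`
(stmt-QuantumFields-23134; depths `K < N₁·j`). -/
theorem stub_meanDeviationDeep : Summit.QuantumFields.YangMills.Theses.RevelationMartingale.MeanDeviationDeepL := by
  sorry

/-- Merge of the two depth ranges (`γ₁ := min`, `Cv := max`). -/
theorem bondRevelation_of
    (h1 : ∀ (L : ℕ) (b₀ p₀ b₂ : ℝ), 0 < b₀ → 2 < p₀ → b₀ ≤ b₂ → ∃ (γ₁ Cv : ℝ), 0 < γ₁ ∧ γ₁ ≤ 1 ∧ 0 < Cv ∧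
            ∀ (F : T3Family) (γ : ℝ), F.L = L → 0 < γ → γ ≤ γ₁ → ∀ (K j : ℕ), j = 1 → 1 ≤ K → ∀ p : Plaq (F.P K) j,
            ∃ (N : ℕ) (e : Fin N → PBond (F.P K) 0), Function.Surjective e ∧
              ∀ ℱ : MeasureTheory.Filtration ℕ
                  (inferInstance : MeasurableSpace (GaugeField (F.P K) 0 (Matrix.specialUnitaryGroup (Fin 2) ℂ))),
                (∀ i, ℱ i = MeasurableSpace.comap
                  (fun (U : GaugeField (F.P K) 0 (Matrix.specialUnitaryGroup (Fin 2) ℂ)) (m : Fin N) =>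
                    if (m : ℕ) < i then U (e m) else (1 : Matrix.specialUnitaryGroup (Fin 2) ℂ)) inferInstance) →
              ∃ σ : ℕ → GaugeField (F.P K) 0 (Matrix.specialUnitaryGroup (Fin 2) ℂ) → ℝ,
                (∀ i, StronglyMeasurable[ℱ i] (σ i)) ∧
                (∀ i U, 0 ≤ σ i U) ∧
                (∀ (i : ℕ) (s : ℝ), ∀ᵐ U ∂(T3UnitScaleTilt.gibbsK F T3UnitLawDensityEML.ℰp γ K),
                  MeasureTheory.condExp (ℱ i) (T3UnitScaleTilt.gibbsK F T3UnitLawDensityEML.ℰp γ K)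
                    (fun U' => Real.exp (s *
                      (MeasureTheory.condExp (ℱ (i + 1)) (T3UnitScaleTilt.gibbsK F T3UnitLawDensityEML.ℰp γ K)
                          (fun V => GaugeGroup.dist1 (GaugeField.plaqHol
                            (Averaging.iter (fun i => BlockAveraging.blockAvg (P := F.P K) (j := i) T3UnitLawDensityEML.ℰp) j V) p)) U' -
                       MeasureTheory.condExp (ℱ i) (T3UnitScaleTilt.gibbsK F T3UnitLawDensityEML.ℰp γ K)
                          (fun V => GaugeGroup.dist1 (GaugeField.plaqHol
                            (Averaging.iter (fun i => BlockAveraging.blockAvg (P := F.P K) (j := i) T3UnitLawDensityEML.ℰp) j V) p)) U'))) U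
                    ≤ Real.exp (s ^ 2 * σ i U / 2)) ∧
                (∀ᵐ U ∂(T3UnitScaleTilt.gibbsK F T3UnitLawDensityEML.ℰp γ K),
                  ((∀ k, k < j → PlaqSmall (T3UnitScaleTilt.θBal F.L γ b₀ p₀ (K - k))
                      (Averaging.iter (fun i => BlockAveraging.blockAvg (P := F.P K) (j := i) T3UnitLawDensityEML.ℰp) k U)) ∧
                    PlaqSmall (T3UnitScaleTilt.θBal F.L γ b₂ p₀ (K - j))
                      (Averaging.iter (fun i => BlockAveraging.blockAvg (P := F.P K) (j := i) T3UnitLawDensityEML.ℰp) j U)) →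
                  ∑ i ∈ Finset.range N, σ i U ≤ Cv * (γ * ((F.L : ℝ)⁻¹) ^ (K - j))))
    (h2 : ∀ (L : ℕ) (b₀ p₀ b₂ : ℝ), 0 < b₀ → 2 < p₀ → b₀ ≤ b₂ → ∃ (γ₁ Cv : ℝ), 0 < γ₁ ∧ γ₁ ≤ 1 ∧ 0 < Cv ∧
            ∀ (F : T3Family) (γ : ℝ), F.L = L → 0 < γ → γ ≤ γ₁ → ∀ (K j : ℕ), 2 ≤ j → j ≤ K → ∀ p : Plaq (F.P K) j,
            ∃ (N : ℕ) (e : Fin N → PBond (F.P K) 0), Function.Surjective e ∧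
              ∀ ℱ : MeasureTheory.Filtration ℕ
                  (inferInstance : MeasurableSpace (GaugeField (F.P K) 0 (Matrix.specialUnitaryGroup (Fin 2) ℂ))),
                (∀ i, ℱ i = MeasurableSpace.comap
                  (fun (U : GaugeField (F.P K) 0 (Matrix.specialUnitaryGroup (Fin 2) ℂ)) (m : Fin N) =>
                    if (m : ℕ) < i then U (e m) else (1 : Matrix.specialUnitaryGroup (Fin 2) ℂ)) inferInstance) →
              ∃ σ : ℕ → GaugeField (F.P K) 0 (Matrix.specialUnitaryGroup (Fin 2) ℂ) → ℝ,
                (∀ i, StronglyMeasurable[ℱ i] (σ i)) ∧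
                (∀ i U, 0 ≤ σ i U) ∧
                (∀ (i : ℕ) (s : ℝ), ∀ᵐ U ∂(T3UnitScaleTilt.gibbsK F T3UnitLawDensityEML.ℰp γ K),
                  MeasureTheory.condExp (ℱ i) (T3UnitScaleTilt.gibbsK F T3UnitLawDensityEML.ℰp γ K)
                    (fun U' => Real.exp (s *
                      (MeasureTheory.condExp (ℱ (i + 1)) (T3UnitScaleTilt.gibbsK F T3UnitLawDensityEML.ℰp γ K)
                          (fun V => GaugeGroup.dist1 (GaugeField.plaqHol
                            (Averaging.iter (fun i => BlockAveraging.blockAvg (P := F.P K) (j := i) T3UnitLawDensityEML.ℰp) j V) p)) U' -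
                       MeasureTheory.condExp (ℱ i) (T3UnitScaleTilt.gibbsK F T3UnitLawDensityEML.ℰp γ K)
                          (fun V => GaugeGroup.dist1 (GaugeField.plaqHol
                            (Averaging.iter (fun i => BlockAveraging.blockAvg (P := F.P K) (j := i) T3UnitLawDensityEML.ℰp) j V) p)) U'))) U
                    ≤ Real.exp (s ^ 2 * σ i U / 2)) ∧
                (∀ᵐ U ∂(T3UnitScaleTilt.gibbsK F T3UnitLawDensityEML.ℰp γ K),
                  ((∀ k, k < j → PlaqSmall (T3UnitScaleTilt.θBal F.L γ b₀ p₀ (K - k))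
                      (Averaging.iter (fun i => BlockAveraging.blockAvg (P := F.P K) (j := i) T3UnitLawDensityEML.ℰp) k U)) ∧
                    PlaqSmall (T3UnitScaleTilt.θBal F.L γ b₂ p₀ (K - j))
                      (Averaging.iter (fun i => BlockAveraging.blockAvg (P := F.P K) (j := i) T3UnitLawDensityEML.ℰp) j U)) →
                  ∑ i ∈ Finset.range N, σ i U ≤ Cv * (γ * ((F.L : ℝ)⁻¹) ^ (K - j)))) :
    ∀ (L : ℕ) (b₀ p₀ b₂ : ℝ), 0 < b₀ → 2 < p₀ → b₀ ≤ b₂ → ∃ (γ₁ Cv : ℝ), 0 < γ₁ ∧ γ₁ ≤ 1 ∧ 0 < Cv ∧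
          ∀ (F : T3Family) (γ : ℝ), F.L = L → 0 < γ → γ ≤ γ₁ → ∀ (K j : ℕ), 1 ≤ j → j ≤ K → ∀ p : Plaq (F.P K) j,
          ∃ (N : ℕ) (e : Fin N → PBond (F.P K) 0), Function.Surjective e ∧
            ∀ ℱ : MeasureTheory.Filtration ℕ
                (inferInstance : MeasurableSpace (GaugeField (F.P K) 0 (Matrix.specialUnitaryGroup (Fin 2) ℂ))),
              (∀ i, ℱ i = MeasurableSpace.comap
                (fun (U : GaugeField (F.P K) 0 (Matrix.specialUnitaryGroup (Fin 2) ℂ)) (m : Fin N) =>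
                  if (m : ℕ) < i then U (e m) else (1 : Matrix.specialUnitaryGroup (Fin 2) ℂ)) inferInstance) →
            ∃ σ : ℕ → GaugeField (F.P K) 0 (Matrix.specialUnitaryGroup (Fin 2) ℂ) → ℝ,
              (∀ i, StronglyMeasurable[ℱ i] (σ i)) ∧
              (∀ i U, 0 ≤ σ i U) ∧
              (∀ (i : ℕ) (s : ℝ), ∀ᵐ U ∂(T3UnitScaleTilt.gibbsK F T3UnitLawDensityEML.ℰp γ K),
                MeasureTheory.condExp (ℱ i) (T3UnitScaleTilt.gibbsK F T3UnitLawDensityEML.ℰp γ K)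
                  (fun U' => Real.exp (s *
                    (MeasureTheory.condExp (ℱ (i + 1)) (T3UnitScaleTilt.gibbsK F T3UnitLawDensityEML.ℰp γ K)
                        (fun V => GaugeGroup.dist1 (GaugeField.plaqHol
                          (Averaging.iter (fun i => BlockAveraging.blockAvg (P := F.P K) (j := i) T3UnitLawDensityEML.ℰp) j V) p)) U' -
                     MeasureTheory.condExp (ℱ i) (T3UnitScaleTilt.gibbsK F T3UnitLawDensityEML.ℰp γ K)
                        (fun V => GaugeGroup.dist1 (GaugeField.plaqHol
                          (Averaging.iter (fun i => BlockAveraging.blockAvg (P := F.P K) (j := i) T3UnitLawDensityEML.ℰp) j V) p)) U'))) U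
                  ≤ Real.exp (s ^ 2 * σ i U / 2)) ∧
              (∀ᵐ U ∂(T3UnitScaleTilt.gibbsK F T3UnitLawDensityEML.ℰp γ K),
                ((∀ k, k < j → PlaqSmall (T3UnitScaleTilt.θBal F.L γ b₀ p₀ (K - k))
                    (Averaging.iter (fun i => BlockAveraging.blockAvg (P := F.P K) (j := i) T3UnitLawDensityEML.ℰp) k U)) ∧
                  PlaqSmall (T3UnitScaleTilt.θBal F.L γ b₂ p₀ (K - j))
                    (Averaging.iter (fun i => BlockAveraging.blockAvg (P := F.P K) (j := i) T3UnitLawDensityEML.ℰp) j U)) →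
                ∑ i ∈ Finset.range N, σ i U ≤ Cv * (γ * ((F.L : ℝ)⁻¹) ^ (K - j))) := by
  intro L b₀ p₀ b₂ hb₀ hp₀ hb₂
  obtain ⟨γa, Ca, hγa, hγa1, hCa, hFa⟩ := h1 L b₀ p₀ b₂ hb₀ hp₀ hb₂
  obtain ⟨γb, Cb, hγb, hγb1, hCb, hFb⟩ := h2 L b₀ p₀ b₂ hb₀ hp₀ hb₂
  refine ⟨min γa γb, max Ca Cb, lt_min hγa hγb, (min_le_left _ _).trans hγa1, lt_max_of_lt_left hCa, ?_⟩
  intro F γ hL hγ hγle K j hj hjK p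
  have hmono : ∀ (Cv : ℝ), Cv ≤ max Ca Cb →
      (      ∃ (N : ℕ) (e : Fin N → PBond (F.P K) 0), Function.Surjective e ∧
              ∀ ℱ : MeasureTheory.Filtration ℕ
                  (inferInstance : MeasurableSpace (GaugeField (F.P K) 0 (Matrix.specialUnitaryGroup (Fin 2) ℂ))),
                (∀ i, ℱ i = MeasurableSpace.comap
                  (fun (U : GaugeField (F.P K) 0 (Matrix.specialUnitaryGroup (Fin 2) ℂ)) (m : Fin N) =>
                    if (m : ℕ) < i then U (e m) else (1 : Matrix.specialUnitaryGroup (Fin 2) ℂ)) inferInstance) →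
              ∃ σ : ℕ → GaugeField (F.P K) 0 (Matrix.specialUnitaryGroup (Fin 2) ℂ) → ℝ,
                (∀ i, StronglyMeasurable[ℱ i] (σ i)) ∧
                (∀ i U, 0 ≤ σ i U) ∧
                (∀ (i : ℕ) (s : ℝ), ∀ᵐ U ∂(T3UnitScaleTilt.gibbsK F T3UnitLawDensityEML.ℰp γ K),
                  MeasureTheory.condExp (ℱ i) (T3UnitScaleTilt.gibbsK F T3UnitLawDensityEML.ℰp γ K)
                    (fun U' => Real.exp (s *
                      (MeasureTheory.condExp (ℱ (i + 1)) (T3UnitScaleTilt.gibbsK F T3UnitLawDensityEML.ℰp γ K)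
                          (fun V => GaugeGroup.dist1 (GaugeField.plaqHol
                            (Averaging.iter (fun i => BlockAveraging.blockAvg (P := F.P K) (j := i) T3UnitLawDensityEML.ℰp) j V) p)) U' -
                       MeasureTheory.condExp (ℱ i) (T3UnitScaleTilt.gibbsK F T3UnitLawDensityEML.ℰp γ K)
                          (fun V => GaugeGroup.dist1 (GaugeField.plaqHol
                            (Averaging.iter (fun i => BlockAveraging.blockAvg (P := F.P K) (j := i) T3UnitLawDensityEML.ℰp) j V) p)) U'))) U
                    ≤ Real.exp (s ^ 2 * σ i U / 2)) ∧
                (∀ᵐ U ∂(T3UnitScaleTilt.gibbsK F T3UnitLawDensityEML.ℰp γ K),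
                  ((∀ k, k < j → PlaqSmall (T3UnitScaleTilt.θBal F.L γ b₀ p₀ (K - k))
                      (Averaging.iter (fun i => BlockAveraging.blockAvg (P := F.P K) (j := i) T3UnitLawDensityEML.ℰp) k U)) ∧
                    PlaqSmall (T3UnitScaleTilt.θBal F.L γ b₂ p₀ (K - j))
                      (Averaging.iter (fun i => BlockAveraging.blockAvg (P := F.P K) (j := i) T3UnitLawDensityEML.ℰp) j U)) →
                  ∑ i ∈ Finset.range N, σ i U ≤ Cv * (γ * ((F.L : ℝ)⁻¹) ^ (K - j)))) →
      (      ∃ (N : ℕ) (e : Fin N → PBond (F.P K) 0), Function.Surjective e ∧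
              ∀ ℱ : MeasureTheory.Filtration ℕ
                  (inferInstance : MeasurableSpace (GaugeField (F.P K) 0 (Matrix.specialUnitaryGroup (Fin 2) ℂ))),
                (∀ i, ℱ i = MeasurableSpace.comap
                  (fun (U : GaugeField (F.P K) 0 (Matrix.specialUnitaryGroup (Fin 2) ℂ)) (m : Fin N) =>
                    if (m : ℕ) < i then U (e m) else (1 : Matrix.specialUnitaryGroup (Fin 2) ℂ)) inferInstance) →
              ∃ σ : ℕ → GaugeField (F.P K) 0 (Matrix.specialUnitaryGroup (Fin 2) ℂ) → ℝ,
                (∀ i, StronglyMeasurable[ℱ i] (σ i)) ∧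
                (∀ i U, 0 ≤ σ i U) ∧
                (∀ (i : ℕ) (s : ℝ), ∀ᵐ U ∂(T3UnitScaleTilt.gibbsK F T3UnitLawDensityEML.ℰp γ K),
                  MeasureTheory.condExp (ℱ i) (T3UnitScaleTilt.gibbsK F T3UnitLawDensityEML.ℰp γ K)
                    (fun U' => Real.exp (s *
                      (MeasureTheory.condExp (ℱ (i + 1)) (T3UnitScaleTilt.gibbsK F T3UnitLawDensityEML.ℰp γ K)
                          (fun V => GaugeGroup.dist1 (GaugeField.plaqHol
                            (Averaging.iter (fun i => BlockAveraging.blockAvg (P := F.P K) (j := i) T3UnitLawDensityEML.ℰp) j V) p)) U' -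
                       MeasureTheory.condExp (ℱ i) (T3UnitScaleTilt.gibbsK F T3UnitLawDensityEML.ℰp γ K)
                          (fun V => GaugeGroup.dist1 (GaugeField.plaqHol
                            (Averaging.iter (fun i => BlockAveraging.blockAvg (P := F.P K) (j := i) T3UnitLawDensityEML.ℰp) j V) p)) U'))) U
                    ≤ Real.exp (s ^ 2 * σ i U / 2)) ∧
                (∀ᵐ U ∂(T3UnitScaleTilt.gibbsK F T3UnitLawDensityEML.ℰp γ K),
                  ((∀ k, k < j → PlaqSmall (T3UnitScaleTilt.θBal F.L γ b₀ p₀ (K - k))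
                      (Averaging.iter (fun i => BlockAveraging.blockAvg (P := F.P K) (j := i) T3UnitLawDensityEML.ℰp) k U)) ∧
                    PlaqSmall (T3UnitScaleTilt.θBal F.L γ b₂ p₀ (K - j))
                      (Averaging.iter (fun i => BlockAveraging.blockAvg (P := F.P K) (j := i) T3UnitLawDensityEML.ℰp) j U)) →
                  ∑ i ∈ Finset.range N, σ i U ≤ max Ca Cb * (γ * ((F.L : ℝ)⁻¹) ^ (K - j)))) := by
    intro Cv hCv hAt
    obtain ⟨N, e, he, hAll⟩ := hAt
    refine ⟨N, e, he, fun ℱ hℱ => ?_⟩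
    obtain ⟨σ, hσm, hσ0, hmgf, hwin⟩ := hAll ℱ hℱ
    refine ⟨σ, hσm, hσ0, hmgf, ?_⟩
    filter_upwards [hwin] with U hU
    intro hW
    have hg : 0 ≤ γ * ((F.L : ℝ)⁻¹) ^ (K - j) := by positivity
    exact (hU hW).trans (mul_le_mul_of_nonneg_right hCv hg)
  by_cases hj1 : j = 1
  · exact hmono Ca (le_max_left _ _) (hFa F γ hL hγ (hγle.trans (min_le_left _ _)) K j hj1 (hj.trans hjK) p)
  · have hj2 : 2 ≤ j := by omega
    exact hmono Cb (le_max_right _ _) (hFb F γ hL hγ (hγle.trans (min_le_right _ _)) K j hj2 hjK p)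

/-- The deciding crux `SubGaussianRevelationL` (stmt-QuantumFields-23082) from the mechanism-specific stubs. -/
theorem SubGaussianRevelationL_of_stubs :
    Summit.QuantumFields.YangMills.Theses.RevelationMartingale.SubGaussianRevelationL :=
  revelationMartingale_subGaussianRevelationL_of_bondRevelation
    (bondRevelation_of stub_levelOneBondRevelation stub_higherBondRevelation)

/-- COMPOSITION: the stubs (with the LANDED engine p656379, glue p655698, bond filtration p657133 and the K.2 reduction) give
the crux BY NAME. -/
theorem HistoryTailL_of : Summit.QuantumFields.YangMills.Theses.UnitScaleTilt.HistoryTailL :=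
  unitScaleTilt_historyTailL_of_firstExitWindowTailL
    (revelationMartingale_windowTailOfMartingale_proof revelationMartingale_predictableHoeffding_proof
      (revelationMartingale_subGaussianRevelationL_of_bondRevelation
        (bondRevelation_of stub_levelOneBondRevelation stub_higherBondRevelation))
      (revelationMartingale_meanDeviationLGlue_proof stub_meanDeviationShallow stub_meanDeviationDeep))

end Summit.QuantumFields.YangMills.Cruxes.HistoryTailL.RevelationMartingale
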